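import Summits.AtomisticToContinuum.Crystallization.Theorems.ChartedZeroExcessLayeredLatticeLiouvilleXH

/-!
# Zero-excess layered lattice Liouville — part XI (lens-2 g59, node «SBGlueC2», second half): THE COMPARISON ESTIMATE (E1)

Critic rows 1051/1119 (ORDER OF RECORD for `stmt-AtomisticToContinuum-26636`): leaf (2) `SubWindowBudgetGlueBPG` via SBGlueA–D.  Memo NODE-g59a §2: one step of the
index-side Campanato recursion = (E1) comparison · (E2) decay · (E3) rigidity · (E4) re-chart.  This file PROVES (E1) in closed form, with every route input
entering as an INSTANCE hypothesis of the literal shape the corresponding clause delivers: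

* ★★ `comparison_estimate`: for a bijective `4 ↦ D` tear-free registration `Ψ : S → Layered a b w` of a `δ`-separated `S` onto a `c`-co-Lipschitz, `27/32`-separated
  crystal, the (HC) comparison field `V` of `φ = pullDisp S Ψ a b w` on the window `P` (instance `hHC`: `κ₁·E(φ − V)(nbhd1 P) ≤ |Σ_P ⟪truncResidual φ, φ − V⟫|`), the
  (PT) identity at every site (instance `hPT`), the (I1) Taylor constant `C_T` (instance `hCT`), a gradient bound `δ⋆ ≤ 1/4` on the `ϱ`-near pairs of the index
  window, and the (I4ˢ) far-field flux bound at `(x, t, τ, Θ)` for all test fields supported in `S ∩ ball x t` (instance `hI4`) give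
  `κ₁·√E(φ − V)(nbhd1 P) ≤ √dictA(c,D)·(εf·√(dictA(c,D)·E(φ)(idxBall X₀ m)) + AT·√(Θ·nK(S ∩ ball x τ))/max(τ−t,1)) + ½·C_T·δ⋆·dictA(c,ϱ)·√E(φ)(idxBall X₀ m)`
  — residual pairing = −(tail pairing) − (defect pairing) (XH.1, XH.5); the tail pairing is (I4ˢ) tested against the LIFT of `φ − V` whose bond energy is
  `≤ dictA·E(φ − V)` (XH.5, XF.3) while `bondEnergy (id − Ψ) ≤ dictA·E(φ)` (XF.3); the defect pairing is `≤ ½·C_T·δ⋆·dictA(c,ϱ)·√E(φ)·√E(φ−V)` (XH.1–XH.3);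
  divide by `√E(φ − V)`.  The geometric side conditions (`P ⊆ idxBallF X₀ m ⊇` its `ϱ`-near sites and `nbhd1 P`; atoms of `P` in `ball x t`; index sites of
  `S ∩ ball x τ` in `idxBall X₀ m`) are exactly what XD.5/XF.2 deliver for `P = idxBallF X₀ n`, `m = n + ϱ/c + 1`, `t = (28/25)(6C₁n+8)+1`, `τ = 2t` (part XJ).
-/

noncomputable section

open scoped BigOperators InnerProductSpace RealInnerProductSpace
open Set Function Metric
open Summit.AtomisticToContinuum.Crystallization.Theorems.ChartedPlanarOrderRigidityDoor (E3 IsClean)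
open Summit.AtomisticToContinuum.Crystallization.Theorems.ChartedPlanarOrderDensityDichotomy (μS IsSep nK)
open Summit.AtomisticToContinuum.Crystallization.Theorems.ChartedPlanarOrderDoorLayered (Layered)

namespace Summit.AtomisticToContinuum.Crystallization.Theorems.ChartedZeroExcessLayeredLatticeLiouville

section Comparison

variable {S : Set E3} {Ψ : E3 → E3} {a b : E3} {w : ℤ → E3} {c : ℝ}

/-- ★★ **THE COMPARISON ESTIMATE (E1)** of the index-side Campanato step (memo NODE-g59a §2): (HC) + (PT) + (I1) + (I4ˢ) bound the energy of `φ − V` on the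
window by the far-field flux budget and the quadratic defect — see the module docstring for the shape and the proof. [this file, g59] -/
theorem comparison_estimate
    (hbij : BijOn Ψ S (Layered a b w)) (hc : 0 < c) (hcr : IsLayeredCrystal c a b w) (hsepH : IsSep (27 / 32) (Layered a b w))
    {δ : ℝ} (hδ : 0 < δ) (hsep : IsSep δ S) {D : ℝ} (h4D : ∀ x ∈ S, ∀ p ∈ S, dist p x ≤ 4 → dist (Ψ p) (Ψ x) ≤ D)
    {ϱ CT : ℝ} (hCT0 : 0 ≤ CT) (hCT : ∀ z v : E3, 27 / 32 ≤ ‖z‖ → ‖v‖ ≤ 1 / 4 → ‖defectKernel z v‖ ≤ CT * ‖v‖ ^ 2)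
    (hPT : ∀ X : Cell 2 × ℤ, truncResidual ϱ a b w (pullDisp S Ψ a b w) X + tailForce ϱ S (Layered a b w) Ψ (atomOf S Ψ a b w X) =
      -defectSum ϱ a b w (pullDisp S Ψ a b w) X)
    {X₀ : Cell 2 × ℤ} {m : ℝ} {P : Finset (Cell 2 × ℤ)} (hPm : P ⊆ idxBallF X₀ m)
    (hPU : ∀ X ∈ P, ∀ Y : Cell 2 × ℤ, ‖lsite a b w Y.1 Y.2 - lsite a b w X.1 X.2‖ ≤ ϱ → Y ∈ idxBallF X₀ m)
    (hP1 : nbhd1 ↑P ⊆ idxBall X₀ m) {δs : ℝ} (hδs0 : 0 ≤ δs) (hδs : δs ≤ 1 / 4)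
    (hgrad : ∀ e ∈ nearPairs a b w ϱ (idxBallF X₀ m), ‖pullDisp S Ψ a b w e.1.1 e.1.2 - pullDisp S Ψ a b w e.2.1 e.2.2‖ ≤ δs)
    {κ₁ : ℝ} {V : Cell 2 → ℤ → E3} (hVoff : ∀ X : Cell 2 × ℤ, X ∉ (↑P : Set (Cell 2 × ℤ)) → V X.1 X.2 = pullDisp S Ψ a b w X.1 X.2)
    (hHC : κ₁ * idxEnergy (pullDisp S Ψ a b w - V) (nbhd1 ↑P) ≤
      |∑ᶠ X ∈ (↑P : Set (Cell 2 × ℤ)), ⟪truncResidual ϱ a b w (pullDisp S Ψ a b w) X, pullDisp S Ψ a b w X.1 X.2 - V X.1 X.2⟫_ℝ|)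
    {x : E3} {t τ Θ εf AT : ℝ} (hεf : 0 ≤ εf) (hAT : 0 ≤ AT)
    (hPt : ∀ X ∈ P, atomOf S Ψ a b w X ∈ ball x t) (hτm : ∀ p ∈ S ∩ ball x τ, idxOf a b w (Ψ p) ∈ idxBall X₀ m)
    (hI4 : ∀ g : E3 → E3, (∀ y, y ∉ S ∩ ball x t → g y = 0) →
      |∑ᶠ y ∈ S ∩ ball x t, ⟪tailForce ϱ S (Layered a b w) Ψ y, g y⟫_ℝ| ≤
        (εf * Real.sqrt (bondEnergy (S ∩ ball x τ) (fun p => p - Ψ p)) + AT * Real.sqrt (Θ * nK (S ∩ ball x τ)) / max (τ - t) 1) *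
          Real.sqrt (bondEnergy (S ∩ ball x τ) g)) :
    κ₁ * Real.sqrt (idxEnergy (pullDisp S Ψ a b w - V) (nbhd1 ↑P)) ≤
      Real.sqrt (dictA c D) * (εf * Real.sqrt (dictA c D * idxEnergy (pullDisp S Ψ a b w) (idxBall X₀ m)) +
          AT * Real.sqrt (Θ * nK (S ∩ ball x τ)) / max (τ - t) 1) +
        1 / 2 * CT * δs * dictA c ϱ * Real.sqrt (idxEnergy (pullDisp S Ψ a b w) (idxBall X₀ m)) := by
  set φ : Cell 2 → ℤ → E3 := pullDisp S Ψ a b w with hφ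
  set ψ : Cell 2 → ℤ → E3 := φ - V with hψdef
  have hψX : ∀ X : Cell 2 × ℤ, ψ X.1 X.2 = φ X.1 X.2 - V X.1 X.2 := fun X => by simp only [hψdef, Pi.sub_apply]
  have hψP : ∀ X : Cell 2 × ℤ, X ∉ (↑P : Set (Cell 2 × ℤ)) → ψ X.1 X.2 = 0 := fun X hX => by rw [hψX, hVoff X hX, sub_self]
  have hψP' : ∀ X : Cell 2 × ℤ, X ∉ P → ψ X.1 X.2 = 0 := fun X hX => hψP X fun h => hX (Finset.mem_coe.1 h)
  have hPt' : ∀ X ∈ (↑P : Set (Cell 2 × ℤ)), atomOf S Ψ a b w X ∈ ball x t := fun X hX => hPt X (Finset.mem_coe.1 hX)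
  set Eψ : ℝ := idxEnergy ψ (nbhd1 ↑P) with hEψ
  set Eφ : ℝ := idxEnergy φ (idxBall X₀ m) with hEφ
  have hEm : idxEnergy ψ (idxBall X₀ m) = Eψ := idxEnergy_eq_nbhd1_of_vanish hψP hP1
  have hEψ0 : 0 ≤ Eψ := idxEnergy_nonneg _ _
  have hEφ0 : 0 ≤ Eφ := idxEnergy_nonneg _ _
  have hQτ : (S ∩ ball x τ).Finite := finite_inter_ball_of_isSep hδ hsep x τ
  have hM : 0 < max (τ - t) 1 := lt_max_of_lt_right one_pos
  -- Step 1: the residual pairing splits into the tail pairing and the defect pairing, by (PT)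
  have hsplit : ∑ᶠ X ∈ (↑P : Set (Cell 2 × ℤ)), ⟪truncResidual ϱ a b w φ X, φ X.1 X.2 - V X.1 X.2⟫_ℝ =
      -(∑ X ∈ P, ⟪tailForce ϱ S (Layered a b w) Ψ (atomOf S Ψ a b w X), ψ X.1 X.2⟫_ℝ) -
        ∑ X ∈ P, ⟪defectSum ϱ a b w φ X, ψ X.1 X.2⟫_ℝ := by
    rw [finsum_mem_coe_finset, ← Finset.sum_neg_distrib, ← Finset.sum_sub_distrib]
    refine Finset.sum_congr rfl fun X _ => ?_
    rw [eq_sub_of_add_eq (hPT X), ← hψX, inner_sub_left, inner_neg_left]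
    ring
  -- Step 2: the tail pairing, by (I4ˢ) tested against the lift of `ψ`
  have htail : |∑ X ∈ P, ⟪tailForce ϱ S (Layered a b w) Ψ (atomOf S Ψ a b w X), ψ X.1 X.2⟫_ℝ| ≤
      (εf * Real.sqrt (dictA c D * Eφ) + AT * Real.sqrt (Θ * nK (S ∩ ball x τ)) / max (τ - t) 1) *
        (Real.sqrt (dictA c D) * Real.sqrt Eψ) := by
    rw [← finsum_inner_liftField_eq hbij hc hcr hψP' hPt]
    have h1 := hI4 (liftField S Ψ a b w ψ) fun y hy => liftField_eq_zero hbij hψP hPt' hy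
    have hbl : bondEnergy (S ∩ ball x τ) (liftField S Ψ a b w ψ) ≤ dictA c D * Eψ := by
      rw [← hEm]
      exact bondEnergy_liftField_le hbij hc hcr h4D inter_subset_left hQτ hτm ψ
    have hbu : bondEnergy (S ∩ ball x τ) (fun p => p - Ψ p) ≤ dictA c D * Eφ :=
      bondEnergy_disp_le hbij hc hcr h4D inter_subset_left hQτ hτm
    have hA : εf * Real.sqrt (bondEnergy (S ∩ ball x τ) (fun p => p - Ψ p)) + AT * Real.sqrt (Θ * nK (S ∩ ball x τ)) / max (τ - t) 1 ≤
        εf * Real.sqrt (dictA c D * Eφ) + AT * Real.sqrt (Θ * nK (S ∩ ball x τ)) / max (τ - t) 1 :=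
      add_le_add (mul_le_mul_of_nonneg_left (Real.sqrt_le_sqrt hbu) hεf) le_rfl
    have hB : Real.sqrt (bondEnergy (S ∩ ball x τ) (liftField S Ψ a b w ψ)) ≤ Real.sqrt (dictA c D) * Real.sqrt Eψ := by
      rw [← Real.sqrt_mul (dictA_nonneg c D)]
      exact Real.sqrt_le_sqrt hbl
    have hA0 : 0 ≤ εf * Real.sqrt (dictA c D * Eφ) + AT * Real.sqrt (Θ * nK (S ∩ ball x τ)) / max (τ - t) 1 := by positivity
    exact h1.trans (mul_le_mul hA hB (Real.sqrt_nonneg _) hA0)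
  -- Step 3: the defect pairing, by antisymmetrisation, (I1) and Cauchy–Schwarz
  have hdef : |∑ X ∈ P, ⟪defectSum ϱ a b w φ X, ψ X.1 X.2⟫_ℝ| ≤ 1 / 2 * CT * δs * dictA c ϱ * Real.sqrt Eφ * Real.sqrt Eψ := by
    refine (abs_sum_inner_defectSum_le hPm hPU φ hψP').trans ?_
    have h2 := sum_nearPairs_defect_le hCT0 hCT hsepH hc hcr (idxBallF X₀ m) hδs0 hδs hgrad ψ
    have h3 : Real.sqrt (∑ e ∈ nearPairs a b w ϱ (idxBallF X₀ m), ‖φ e.1.1 e.1.2 - φ e.2.1 e.2.2‖ ^ 2) ≤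
        Real.sqrt (dictA c ϱ) * Real.sqrt Eφ := by
      rw [← Real.sqrt_mul (dictA_nonneg c ϱ)]
      exact Real.sqrt_le_sqrt (sum_nearPairs_sq_le hc hcr X₀ m ϱ φ)
    have h4 : Real.sqrt (∑ e ∈ nearPairs a b w ϱ (idxBallF X₀ m), ‖ψ e.1.1 e.1.2 - ψ e.2.1 e.2.2‖ ^ 2) ≤
        Real.sqrt (dictA c ϱ) * Real.sqrt Eψ := by
      rw [← Real.sqrt_mul (dictA_nonneg c ϱ), ← hEm]
      exact Real.sqrt_le_sqrt (sum_nearPairs_sq_le hc hcr X₀ m ϱ ψ)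
    have h5 : Real.sqrt (∑ e ∈ nearPairs a b w ϱ (idxBallF X₀ m), ‖φ e.1.1 e.1.2 - φ e.2.1 e.2.2‖ ^ 2) *
        Real.sqrt (∑ e ∈ nearPairs a b w ϱ (idxBallF X₀ m), ‖ψ e.1.1 e.1.2 - ψ e.2.1 e.2.2‖ ^ 2) ≤
          (Real.sqrt (dictA c ϱ) * Real.sqrt Eφ) * (Real.sqrt (dictA c ϱ) * Real.sqrt Eψ) :=
      mul_le_mul h3 h4 (Real.sqrt_nonneg _) (by positivity)
    have e : Real.sqrt (dictA c ϱ) * Real.sqrt (dictA c ϱ) = dictA c ϱ := Real.mul_self_sqrt (dictA_nonneg c ϱ)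
    calc 1 / 2 * ∑ e ∈ nearPairs a b w ϱ (idxBallF X₀ m), ‖defectPair a b w φ e.1 e.2‖ * ‖ψ e.1.1 e.1.2 - ψ e.2.1 e.2.2‖
        ≤ 1 / 2 * (CT * δs * ((Real.sqrt (dictA c ϱ) * Real.sqrt Eφ) * (Real.sqrt (dictA c ϱ) * Real.sqrt Eψ))) :=
          mul_le_mul_of_nonneg_left (h2.trans (mul_le_mul_of_nonneg_left h5 (mul_nonneg hCT0 hδs0))) (by norm_num)
      _ = 1 / 2 * CT * δs * (Real.sqrt (dictA c ϱ) * Real.sqrt (dictA c ϱ)) * Real.sqrt Eφ * Real.sqrt Eψ := by ring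
      _ = 1 / 2 * CT * δs * dictA c ϱ * Real.sqrt Eφ * Real.sqrt Eψ := by rw [e]
  -- Step 4: combine and divide by `√Eψ`
  set W : ℝ := Real.sqrt (dictA c D) * (εf * Real.sqrt (dictA c D * Eφ) + AT * Real.sqrt (Θ * nK (S ∩ ball x τ)) / max (τ - t) 1) +
    1 / 2 * CT * δs * dictA c ϱ * Real.sqrt Eφ with hW
  have hdA : 0 ≤ dictA c ϱ := dictA_nonneg c ϱ
  have hW0 : 0 ≤ W := by rw [hW]; positivity
  have hkey : κ₁ * Eψ ≤ W * Real.sqrt Eψ := by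
    calc κ₁ * Eψ ≤ _ := hHC
      _ = |-(∑ X ∈ P, ⟪tailForce ϱ S (Layered a b w) Ψ (atomOf S Ψ a b w X), ψ X.1 X.2⟫_ℝ) -
            ∑ X ∈ P, ⟪defectSum ϱ a b w φ X, ψ X.1 X.2⟫_ℝ| := by rw [hsplit]
      _ ≤ |∑ X ∈ P, ⟪tailForce ϱ S (Layered a b w) Ψ (atomOf S Ψ a b w X), ψ X.1 X.2⟫_ℝ| +
            |∑ X ∈ P, ⟪defectSum ϱ a b w φ X, ψ X.1 X.2⟫_ℝ| := by
          rw [← neg_add', abs_neg]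
          exact abs_add_le _ _
      _ ≤ _ := add_le_add htail hdef
      _ = W * Real.sqrt Eψ := by rw [hW]; ring
  by_cases hE : Eψ = 0
  · rw [hE, Real.sqrt_zero, mul_zero]
    exact hW0
  · have hpos : 0 < Real.sqrt Eψ := Real.sqrt_pos.2 (lt_of_le_of_ne hEψ0 (Ne.symm hE))
    have h : κ₁ * Real.sqrt Eψ * Real.sqrt Eψ ≤ W * Real.sqrt Eψ := by
      rw [mul_assoc, Real.mul_self_sqrt hEψ0]
      exact hkey
    exact le_of_mul_le_mul_right h hpos

end Comparison

end Summit.AtomisticToContinuum.Crystallization.Theorems.ChartedZeroExcessLayeredLatticeLiouville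

end
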